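import Summits.FinalStateConjecture.FinalStateConjecture.Theses.StarvedNecks

/-!
# Route StarvedNecks — support `DiagonalRadii`: diagonal extraction of slowly growing radii

If `a : ℝ → ℝ → ℝ≥0∞` is monotone (non-decreasing) in its first argument (the radius) and
`a ρ τ → 0` as `τ → ∞` for every fixed radius `ρ`, then there is a monotone, continuous
`Rg : ℝ → ℝ` with `Rg τ → ∞` and `a (Rg τ) τ → 0` (`τ → ∞`).  This is the route decl
`Summit.FinalStateConjecture.FinalStateConjecture.Theses.StarvedNecks.DiagonalRadii`
(item stmt-FinalStateConjecture-13552), proved here as `diagonalRadii_proof`.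

Construction (the standard diagonal argument; elementary real analysis, Mathlib only):
* thresholds `T k` with `a k τ ≤ k⁻¹` for `τ ≥ T k` (`ENNReal.tendsto_atTop_zero`);
* monotone thresholds `t k := partialSups T k + k ≥ T k`, `t k ≥ T 0 + k → ∞`;
* the ramp `Rg τ := ⨆ n : ℕ, min n (max 0 (τ - t (n + 1)))` (`exists_slow_ramp`): a pointwise
  bounded supremum of monotone `1`-Lipschitz functions, hence monotone and `1`-Lipschitz
  (`LipschitzWith.of_le_add`), with `n ≤ Rg τ` once `t (n + 1) + n ≤ τ` and `Rg τ ≤ m` while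
  `τ < t (m + 1)`;
* for `t m ≤ τ < t (m + 1)` (such an `m` exists past `t (M + 1)` by `Nat.find` on `τ < t ·`):
  `a (Rg τ) τ ≤ a m τ ≤ m⁻¹ ≤ M⁻¹`.

No named facts, no definitions.  The route cites M. Dafermos, G. Holzegel, I. Rodnianski,
M. Taylor, arXiv:2104.08222 and R. Bartnik, Comm. Pure Appl. Math. 39 (1986) 661–693 only for
where this is applied (`truncDeviationCk`, monotone in the radius); neither is used in the proof.
-/

noncomputable section

-- `Summit.FinalStateConjecture.FinalStateConjecture.…` is the tree's mandated namespace (summit = sub-problem).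
set_option linter.dupNamespace false

open Set Filter Topology
open scoped ENNReal Topology

namespace Summit.FinalStateConjecture.FinalStateConjecture.Theorems.DiagonalRadii

/-- The clipped ramp `x ↦ min c (max 0 (x - s))` is `1`-Lipschitz in the additive form
`f x ≤ f y + dist x y` used by `LipschitzWith.of_le_add`. [folklore] -/
theorem clippedRamp_le_add_dist (c s x y : ℝ) :
    min c (max 0 (x - s)) ≤ min c (max 0 (y - s)) + dist x y := by
  have hd : x - y ≤ dist x y := by
    rw [Real.dist_eq]
    exact le_abs_self _
  have h0 : (0 : ℝ) ≤ dist x y := dist_nonneg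
  have h1 : max 0 (x - s) ≤ max 0 (y - s) + dist x y :=
    max_le (add_nonneg (le_max_left _ _) h0) (by linarith [le_max_right 0 (y - s)])
  calc min c (max 0 (x - s)) ≤ min c (max 0 (y - s) + dist x y) := min_le_min_left _ h1
    _ ≤ min c (max 0 (y - s)) + dist x y := by
        rcases le_total c (max 0 (y - s)) with h | h
        · rw [min_eq_left h]
          exact (min_le_left _ _).trans (le_add_of_nonneg_right h0)
        · rw [min_eq_right h]
          exact min_le_right _ _

/-- **Slow ramp.** For a monotone sequence of thresholds `t : ℕ → ℝ` there is a monotone continuous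
`R : ℝ → ℝ` with `n ≤ R τ` as soon as `t (n + 1) + n ≤ τ` (so `R → ∞`) and `R τ ≤ m` as long as
`τ < t (m + 1)` (so `R` climbs past level `m` only after the threshold `t (m + 1)`).  Witness:
`R τ = ⨆ n, min n (max 0 (τ - t (n + 1)))`. [folklore] -/
theorem exists_slow_ramp (t : ℕ → ℝ) (ht : Monotone t) :
    ∃ R : ℝ → ℝ, Monotone R ∧ Continuous R ∧
      (∀ (n : ℕ) (τ : ℝ), t (n + 1) + n ≤ τ → (n : ℝ) ≤ R τ) ∧
      (∀ (m : ℕ) (τ : ℝ), τ < t (m + 1) → R τ ≤ m) := by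
  have hbdd : ∀ τ : ℝ, BddAbove (range fun n : ℕ => min (n : ℝ) (max 0 (τ - t (n + 1)))) := by
    intro τ
    refine ⟨max 0 (τ - t 0), ?_⟩
    rintro _ ⟨n, rfl⟩
    have h0n : t 0 ≤ t (n + 1) := ht (Nat.zero_le _)
    exact min_le_of_right_le (max_le_max le_rfl (by linarith))
  refine ⟨fun τ => ⨆ n : ℕ, min (n : ℝ) (max 0 (τ - t (n + 1))), ?_, ?_, ?_, ?_⟩
  · -- monotone: each clipped ramp is monotone
    intro x y hxy
    exact ciSup_le fun n =>
      le_trans (min_le_min_left _ (max_le_max_left _ (sub_le_sub_right hxy _)))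
        (le_ciSup (hbdd y) n)
  · -- continuous: the supremum is `1`-Lipschitz
    refine (LipschitzWith.of_le_add fun x y => ?_).continuous
    exact ciSup_le fun n =>
      (clippedRamp_le_add_dist (n : ℝ) (t (n + 1)) x y).trans
        (add_le_add (le_ciSup (hbdd y) n) le_rfl)
  · -- lower bound: the `n`-th ramp has reached its plateau `n`
    intro n τ hτ
    refine le_trans ?_ (le_ciSup (hbdd τ) n)
    exact le_min le_rfl (le_max_of_le_right (by linarith))
  · -- upper bound: below `t (m + 1)` every ramp of level `> m` is still `0`
    intro m τ hτ
    refine ciSup_le fun n => ?_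
    rcases le_or_gt n m with hnm | hmn
    · exact min_le_of_left_le (by exact_mod_cast hnm)
    · have h1 : t (m + 1) ≤ t (n + 1) := ht (by omega)
      have h2 : max 0 (τ - t (n + 1)) = 0 := max_eq_left (by linarith)
      rw [h2]
      exact min_le_of_right_le (Nat.cast_nonneg m)

/-- **Diagonal radii** (route StarvedNecks, support item stmt-FinalStateConjecture-13552).
If `a : ℝ → ℝ → ℝ≥0∞` is monotone in the radius `ρ` and `a ρ τ → 0` as `τ → ∞` for every fixed
`ρ`, then some monotone continuous `Rg → ∞` has `a (Rg τ) τ → 0`.  Proof: thresholds `T k`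
(`a k τ ≤ k⁻¹` for `τ ≥ T k`), monotone `t k := partialSups T k + k`, the slow ramp of
`exists_slow_ramp`, and for `t m ≤ τ < t (m + 1)` the bound `a (Rg τ) τ ≤ a m τ ≤ m⁻¹`.
[folklore] -/
theorem diagonalRadii_proof :
    Summit.FinalStateConjecture.FinalStateConjecture.Theses.StarvedNecks.DiagonalRadii := by
  unfold Summit.FinalStateConjecture.FinalStateConjecture.Theses.StarvedNecks.DiagonalRadii
  intro a hmono hlim
  -- thresholds: `a k τ ≤ k⁻¹` for `τ ≥ T k`
  have hT : ∀ k : ℕ, ∃ T : ℝ, ∀ τ ≥ T, a k τ ≤ (k : ℝ≥0∞)⁻¹ := fun k =>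
    ENNReal.tendsto_atTop_zero.1 (hlim k) _ (ENNReal.inv_pos.2 (ENNReal.natCast_ne_top k))
  choose T hT using hT
  -- monotone thresholds dominating `T`, growing at least linearly
  obtain ⟨t, ht_mono, hTt, ht_ge⟩ : ∃ t : ℕ → ℝ, Monotone t ∧ (∀ k, T k ≤ t k) ∧
      (∀ k : ℕ, T 0 + k ≤ t k) := by
    refine ⟨fun k => partialSups T k + k, ?_, ?_, ?_⟩
    · intro i j hij
      exact add_le_add ((partialSups T).monotone hij) (by exact_mod_cast hij)
    · intro k
      have h1 : T k ≤ partialSups T k := le_partialSups T k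
      have h2 : (0 : ℝ) ≤ k := Nat.cast_nonneg k
      change T k ≤ partialSups T k + k
      linarith
    · intro k
      have h1 : T 0 ≤ partialSups T k := le_partialSups_of_le T (Nat.zero_le k)
      change T 0 + (k : ℝ) ≤ partialSups T k + k
      linarith
  have ht_top : Tendsto t atTop atTop :=
    tendsto_atTop_mono ht_ge (tendsto_atTop_add_const_left atTop (T 0) tendsto_natCast_atTop_atTop)
  obtain ⟨R, hRmono, hRcont, hRlow, hRup⟩ := exists_slow_ramp t ht_mono
  refine ⟨R, hRmono, hRcont, ?_, ?_⟩
  · -- `R → ∞`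
    refine tendsto_atTop_atTop.2 fun b => ⟨t (⌈b⌉₊ + 1) + ⌈b⌉₊, fun τ hτ => ?_⟩
    exact (Nat.le_ceil b).trans (hRlow _ _ hτ)
  · -- `a (R τ) τ → 0`
    rw [ENNReal.tendsto_nhds_zero]
    intro ε hε
    obtain ⟨M, hM⟩ := ENNReal.exists_inv_nat_lt hε.ne'
    filter_upwards [eventually_ge_atTop (t (M + 1))] with τ hτ
    -- locate `τ` between consecutive thresholds: `t m ≤ τ < t (m + 1)` with `M + 1 ≤ m`
    have hex : ∃ n, τ < t n := (ht_top.eventually (eventually_gt_atTop τ)).exists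
    classical
    have hn₀ : τ < t (Nat.find hex) := Nat.find_spec hex
    have hMn₀ : M + 1 < Nat.find hex := by
      by_contra h
      exact absurd (hn₀.trans_le (ht_mono (not_lt.1 h))) (not_lt.2 hτ)
    obtain ⟨m, hm⟩ : ∃ m, Nat.find hex = m + 1 := ⟨Nat.find hex - 1, by omega⟩
    have htm : t m ≤ τ := not_lt.1 (Nat.find_min hex (show m < Nat.find hex by omega))
    have hMm : M ≤ m := by omega
    rw [hm] at hn₀
    calc a (R τ) τ ≤ a m τ := hmono τ (hRup m τ hn₀)
      _ ≤ (m : ℝ≥0∞)⁻¹ := hT m τ ((hTt m).trans htm)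
      _ ≤ (M : ℝ≥0∞)⁻¹ := ENNReal.inv_le_inv.2 (by exact_mod_cast hMm)
      _ ≤ ε := hM.le

end Summit.FinalStateConjecture.FinalStateConjecture.Theorems.DiagonalRadii

end
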